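import Summits.QuantumFields.BalabanUV.T4Continuum.Support.NE3CompetitorNestedFix
import Summits.QuantumFields.BalabanUV.T4Continuum.Support.NE3CovariantCompetitor
import HarnessLib

/-!
# T⁴ programme, node NE3 — row E-MLw-(w4)-P-curved, route H♮, row K5c (file 6c): THE S7 COMPETITOR ON THE SLICE — the nested-mean
# fix of the spiked tent competitor differs from `ζ′` by an element of `Ξ₀₀(W)` (ONE lemma for the K6 assembler) and its energy

NE3 (node U1b) formalisation swarm, leaf seat `b2b-balaban-t4-ne3-formalise-leaf-01` (gen 6); row **K5** of ruling ρ-g22-2, sub-row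
**K5c**; the K6 holder's ask (leaf-02-g6, `HOME/CLAIMS.log` 2026-08-20 ≈19:05Z): «leaf-02-g6 consumes the competitor through exactly two
facts — `(nfixW − ζ′) ∈ cornerGaugeSpaceW L k W (tower L N k) (L^k)` as ONE lemma + the energy bound».  THIS FILE states both, over file 5
`NE3CovariantCompetitor` (`competitorW`: exact corners, single-scale means), file 6b `NE3CompetitorNestedFix` (`nfixW`: nested means exact,
corners kept) and K0b `NE3FrameFreeSliceW.cornerGaugeSpaceW` (leaf-02-g5) BY NAME.

THE OBJECT (`M = L^(j+1)`, `k = j+1`).  For a 𝔲(n)-valued `(tower L N (j+1))`-periodic fine field `ζ` (the gauge potential `ζ′` of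
route H♮) and an `N`-periodic 𝔲(n)-valued mean datum `b` (the consumer's choice: `bmeanW M W ζ` or `bmeanIterW L (j+1) W ζ`):
**`nfixCompetitorW … b ζ := nfixW … (competitorW M W b (fun z => ζ (M•z))) (bmeanIterW L (j+1) W ζ)`** — the tent interpolant of `b`
+ corner spikes to `ζ`'s corner values + the single-scale mean bump + the nested-mean fix.  CONTENT ([folklore]; 0 sorry; DATA def
`nfixCompetitorW`), multi-level small-field class + `E_j ≤ 1∕2`:
* `bmeanIterW_mem_skewAdjoint'` (the nested mean of a skew field is skew — `star_bmeanIterW`);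
* **`nfixCompetitorW_sub_mem_cornerGaugeSpaceW`**: `(fun y => nfixCompetitorW … b ζ y − ζ y) ∈ cornerGaugeSpaceW L (j+1) W (tower L N (j+1)) (L^(j+1))`
  — periodic, corner-trivial, skew AND nested-mean-zero: THE Ξ₀₀(W) MEMBERSHIP the min-norm step S6 needs, EXACTLY;
* **`sum_normSq_gaugeDir_nfixCompetitorW_le`**: the energy = file 6b's bound at `F₀ := competitorW …` (whose own energy is file 5's END
  `sum_normSq_gaugeDir_competitorW_le`): `≤ 2·Σ‖gaugeDir W (competitorW …)‖² + 2·(d·M^d·κ²)·(2∕tentMean)²·Σ_z ‖bmeanIterW ζ z − bmeanIterW (competitorW …) z‖²`.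

HONEST FRAMING.  Kinematics of OUR competitor at one background in the multi-level small-field class; nothing about Bałaban's minimisers;
(P♮)_W ∕ (ML_w) at W ≠ 1, T-E_w and **NE3 are NOT proved**; spine PROVED 0∕9; finite T⁴ rung (B)+1 — NOT infinite volume, NOT mass gap,
NOT `BetaPertH`, NOT Clay.  PLACEMENT: `Summits/QuantumFields/BalabanUV/`.  HONEST DEPENDENCY (cell page 1): continuum YM on T⁴ ⇐ BetaPertH
∧ nine spine estimates (0/9 proved); BetaPertH ⇐ (D1) ∧ (D4) ∧ CAP+tail; G-an2-4 gates asym, D1 and NE2/3/4.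
-/

set_option autoImplicit false

open scoped BigOperators Matrix.Norms.L2Operator
open Finset

namespace Summit.QuantumFields.BalabanUV.T4Continuum.NE3CompetitorSlice

open Literature.MathematicalPhysics.QuantumFieldTheory.Balaban1983to89
open B7Prop1Explicit B7Prop2Explicit
open T4AveragingDeficitWall (IsUnitaryCfg SmallField Ad)
open T4AveragingDeficitWallBoundary (periodBox mem_periodBox card_periodBox IsPeriodicCfg)
open AveragingDeficitTwoLevelPrep (prop1Radius)
open AveragingDeficitMultiLevelPrep (tower LevelSmall)
open BlockAveragePushDirGauge (gaugeDir)
open NE3CovariantBlockMean (bmeanW bmeanIterW)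
open NE3FrameFreeSliceW (bmeanIterW_add bmeanIterW_smul cornerGaugeSpaceW mem_cornerGaugeSpaceW_iff)
open NE3CurvedCornerGaugeSpace (cornerGaugeSpace₀)
open NE3CurvedProjectedLandau (tower_eq_pow_mul)
open NE3NestedMeanBlockOperator (bmeanIterW_add_period' star_bmeanIterW tentMean)
open NE3CovariantCompetitor (competitorW competitorW_corner competitorW_mem_skewAdjoint competitorW_add_period)
open NE3CompetitorNestedFix (nfixW bmeanIterW_nfixW nfixW_corner nfixW_mem_skewAdjoint nfixW_add_period sum_normSq_gaugeDir_nfixW_le)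
open SpreadLift (loopRad)

noncomputable section

variable {d : ℕ} {n : Type*} [Fintype n] [DecidableEq n]

section Slice

variable [Nonempty n] {L : ℕ} (hL : 2 ≤ L) (j : ℕ) {W : Site d → Fin d → (Matrix n n ℂ)ˣ} {x : ℝ}
  (hWu : IsUnitaryCfg W) (hx : 0 ≤ x) (hsm : LevelSmall d L j x) (hWx : SmallField W x)
  (hE : 4 * (d : ℝ) ^ 2 * ((L : ℝ) ^ (j + 1) - 1) ^ 2 * x + 16 * d * loopRad d L ((prop1Radius d L)^[j] x) ≤ 1 / 2)

include hL hWu hx hsm hWx in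
/-- The nested transported mean of a 𝔲(n)-valued field is 𝔲(n)-valued (multi-level small-field class). [folklore] -/
theorem bmeanIterW_mem_skewAdjoint' {F : Site d → Matrix n n ℂ} (hF : ∀ y, F y ∈ skewAdjoint (Matrix n n ℂ)) (z : Site d) :
    bmeanIterW L (j + 1) W F z ∈ skewAdjoint (Matrix n n ℂ) := by
  have hL1 : 1 ≤ L := by omega
  rw [skewAdjoint.mem_iff, star_bmeanIterW hL1 j hWu hx hsm hWx F z]
  have hfun : (fun y => star (F y)) = (-1 : ℝ) • F := by
    funext y; rw [Pi.smul_apply, (skewAdjoint.mem_iff.mp (hF y)), neg_one_smul]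
  rw [hfun, bmeanIterW_smul, Pi.smul_apply, neg_one_smul]

/-- **THE S7 COMPETITOR ON THE SLICE**: the nested-mean fix (file 6b) of the spiked tent competitor (file 5) of the mean datum `b`, with
corner values those of `ζ` and nested means those of `ζ`. [folklore] -/
def nfixCompetitorW (b ζ : Site d → Matrix n n ℂ) : Site d → Matrix n n ℂ :=
  nfixW hL j hWu hx hsm hWx hE (competitorW (L ^ (j + 1)) W b (fun z => ζ ((((L ^ (j + 1) : ℕ) : ℤ)) • z)))
    (bmeanIterW L (j + 1) W ζ)

/-- **THE Ξ₀₀(W) MEMBERSHIP — ONE LEMMA FOR THE K6 ASSEMBLER** (`N ≥ 1`, `d ≥ 1`; `W` of period `tower L N (j+1)`; `ζ` 𝔲(n)-valued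
and `(tower L N (j+1))`-periodic; `b` 𝔲(n)-valued and `N`-periodic):
`(fun y => nfixCompetitorW … b ζ y − ζ y) ∈ cornerGaugeSpaceW L (j+1) W (tower L N (j+1)) (L^(j+1))` — periodic, corner-trivial, skew,
and NESTED-MEAN-ZERO. [folklore] -/
theorem nfixCompetitorW_sub_mem_cornerGaugeSpaceW (hd : 0 < d) {N : ℕ} (hWP : IsPeriodicCfg W ((tower L N (j + 1) : ℕ) : ℤ))
    {b ζ : Site d → Matrix n n ℂ} (hbs : ∀ z, b z ∈ skewAdjoint (Matrix n n ℂ))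
    (hbP : ∀ (z : Site d) (i : Fin d), b (z + (N : ℤ) • e i) = b z) (hζs : ∀ y, ζ y ∈ skewAdjoint (Matrix n n ℂ))
    (hζP : ∀ (y : Site d) (i : Fin d), ζ (y + ((tower L N (j + 1) : ℕ) : ℤ) • e i) = ζ y) :
    (fun y => nfixCompetitorW hL j hWu hx hsm hWx hE b ζ y - ζ y)
      ∈ cornerGaugeSpaceW (d := d) (n := n) L (j + 1) W (tower L N (j + 1)) (L ^ (j + 1)) := by
  have hL1 : 1 ≤ L := by omega
  have hM1 : 1 ≤ L ^ (j + 1) := Nat.one_le_pow _ _ hL1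
  have htow : tower L N (j + 1) = L ^ (j + 1) * N := tower_eq_pow_mul L N (j + 1)
  have hWP' : IsPeriodicCfg W (((L ^ (j + 1) : ℕ) : ℤ) * N) := by
    have : (((L ^ (j + 1) : ℕ) : ℤ) * N) = ((tower L N (j + 1) : ℕ) : ℤ) := by rw [htow]; push_cast; ring
    rw [this]; exact hWP
  -- the corner datum `c z := ζ (M•z)` is skew and `N`-periodic
  have hcs : ∀ z, ζ ((((L ^ (j + 1) : ℕ) : ℤ)) • z) ∈ skewAdjoint (Matrix n n ℂ) := fun z => hζs _
  have hcP : ∀ (z : Site d) (i : Fin d), ζ ((((L ^ (j + 1) : ℕ) : ℤ)) • (z + (N : ℤ) • e i)) = ζ ((((L ^ (j + 1) : ℕ) : ℤ)) • z) := by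
    intro z i
    have h := hζP ((((L ^ (j + 1) : ℕ) : ℤ)) • z) i
    rw [htow] at h
    rw [← h, smul_add, smul_smul]
    push_cast
    rfl
  -- the two layers
  set F₀ : Site d → Matrix n n ℂ := competitorW (L ^ (j + 1)) W b (fun z => ζ ((((L ^ (j + 1) : ℕ) : ℤ)) • z)) with hF₀
  have hF₀s : ∀ y, F₀ y ∈ skewAdjoint (Matrix n n ℂ) := fun y => competitorW_mem_skewAdjoint _ hWu hbs hcs y
  have hF₀P : ∀ (y : Site d) (i : Fin d), F₀ (y + ((tower L N (j + 1) : ℕ) : ℤ) • e i) = F₀ y := by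
    intro y i
    rw [htow]
    exact competitorW_add_period hM1 hWP' hbP hcP y i
  have hts : ∀ z, bmeanIterW L (j + 1) W ζ z ∈ skewAdjoint (Matrix n n ℂ) := bmeanIterW_mem_skewAdjoint' hL j hWu hx hsm hWx hζs
  have htP : ∀ (z : Site d) (i : Fin d), bmeanIterW L (j + 1) W ζ (z + (N : ℤ) • e i) = bmeanIterW L (j + 1) W ζ z :=
    bmeanIterW_add_period' j hWP hζP
  rw [mem_cornerGaugeSpaceW_iff]
  refine ⟨⟨fun y κ => ?_, fun w => ?_, fun y => ?_⟩, ?_⟩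
  · -- periodicity
    simp only
    rw [hζP]
    unfold nfixCompetitorW
    rw [nfixW_add_period hL j hWu hx hsm hWx hE hWP hF₀P htP]
  · -- corner-triviality
    simp only
    unfold nfixCompetitorW
    rw [nfixW_corner hL j hWu hx hsm hWx hE hd, ← hF₀, hF₀, competitorW_corner hM1 hd, sub_self]
  · -- skewness
    exact (skewAdjoint (Matrix n n ℂ)).sub_mem (nfixW_mem_skewAdjoint hL j hWu hx hsm hWx hE hF₀s hts y) (hζs y)
  · -- nested mean zero
    have hsplit : (fun y => nfixCompetitorW hL j hWu hx hsm hWx hE b ζ y - ζ y)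
        = (fun y => nfixCompetitorW hL j hWu hx hsm hWx hE b ζ y) + ((-1 : ℝ) • ζ) := by
      funext y; simp only [Pi.add_apply, Pi.neg_apply, neg_one_smul, sub_eq_add_neg]
    rw [hsplit, bmeanIterW_add, bmeanIterW_smul]
    funext z
    simp only [Pi.add_apply, Pi.smul_apply, Pi.zero_apply]
    unfold nfixCompetitorW
    rw [bmeanIterW_nfixW, neg_one_smul, add_neg_cancel]

/-- **THE ENERGY OF THE COMPETITOR ON THE SLICE** (`SmallField W a`, `0 ≤ a`, any `N`): file 6b's bound at `F₀ := competitorW …`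
(whose energy is file 5's END `NE3CovariantCompetitor.sum_normSq_gaugeDir_competitorW_le`). [folklore] -/
theorem sum_normSq_gaugeDir_nfixCompetitorW_le (N : ℕ) {a : ℝ} (ha : 0 ≤ a) (hWa : SmallField W a) (b ζ : Site d → Matrix n n ℂ) :
    ∑ y ∈ periodBox (d := d) (L ^ (j + 1) * N), ∑ α : Fin d, ‖gaugeDir W (nfixCompetitorW hL j hWu hx hsm hWx hE b ζ) y α‖ ^ 2
      ≤ 2 * ∑ y ∈ periodBox (d := d) (L ^ (j + 1) * N), ∑ α : Fin d,
            ‖gaugeDir W (competitorW (L ^ (j + 1)) W b (fun z => ζ ((((L ^ (j + 1) : ℕ) : ℤ)) • z))) y α‖ ^ 2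
        + 2 * ((d : ℝ) * (((L ^ (j + 1) : ℕ) : ℝ)) ^ d
              * (1 / (((L ^ (j + 1) : ℕ) : ℝ)) + 2 * (((d : ℝ) - 1) * ((((L ^ (j + 1) : ℕ) : ℝ)) - 1) * a)) ^ 2)
            * ((2 / tentMean d (L ^ (j + 1))) ^ 2
              * ∑ z ∈ periodBox (d := d) N, ‖bmeanIterW L (j + 1) W ζ z
                  - bmeanIterW L (j + 1) W (competitorW (L ^ (j + 1)) W b (fun z => ζ ((((L ^ (j + 1) : ℕ) : ℤ)) • z))) z‖ ^ 2) :=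
  sum_normSq_gaugeDir_nfixW_le hL j hWu hx hsm hWx hE N ha hWa _ _

end Slice

end

end Summit.QuantumFields.BalabanUV.T4Continuum.NE3CompetitorSlice
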